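import Summits.PneNP.PneNP.Theorems.KarlinRubinMonotoneSufficesGreedyParamsN
import Summits.PneNP.PneNP.Theorems.KarlinRubinMonotoneSufficesRoomParams

/-!
# Crux `MonotoneSuffices` (stmt-PneNP-18026), the GREEDY general detector — part 10d: parameters (trials)

Continues part 10c (notation `k, L, t, M`, `μ = n 2^{-t}`):

* `prod_pool_bound_le`, `threading6` — `s₁ |Ω| ≤ #S` whenever `(k+1-t)^t (n^M)^t ≤ #S · ∏_{i<t} 2(k + 2n/2^i)`,
  where `s₁ = (k/(16n))^t 2^{t(t-1)/2} ∈ (0, 1]`, `|Ω| = n^{tM}`; and `n ≤ (k+1-t) M`;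
* `hyper6` — `C(tM, s) C(k, s) ≤ C(n, s) 2^{-k}` for `s = k - ⌊k/2⌋`;
* `trials6` — with `R = ⌈(L+1)/s₁⌉`: `(1-s₁)^R ≤ e^{-(L+1)}` and `R ≤ exp(32 (L+1)²)`, whence
  `R exp(-(L+1)⁶/512) ≤ e^{-(L+1)}` and `R 2^{-k} ≤ e^{-(L+1)}`.
Elementary real arithmetic.
-/

set_option linter.dupNamespace false -- `Summit.PneNP.PneNP.…`: summit = sub-problem name (D-0017 single-conjunct layout)

namespace Summit.PneNP.PneNP.Theorems.MonotoneSuffices.Greedy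

open Real Finset
open Summit.PneNP.PneNP.Theorems.MonotoneSuffices.Room

/-! ### Threading: the success probability of one trial -/

/-- **The product bound**: `∏_{i<t} 2 (k + 2n/2^i) · 2^{t(t-1)/2} ≤ (8n)^t` when `2^t k ≤ 4n`. [folklore] -/
theorem prod_pool_bound_le {n k t : ℕ} (h2tk : 2 ^ t * k ≤ 4 * n) :
    (∏ i ∈ range t, (2 * (k + 2 * n / 2 ^ i))) * 2 ^ (t * (t - 1) / 2) ≤ (8 * n) ^ t := by
  have hsum : ∑ i ∈ range t, i = t * (t - 1) / 2 := Finset.sum_range_id t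
  rw [← hsum, ← prod_pow_eq_pow_sum, ← prod_mul_distrib, ← card_range t, ← prod_const, card_range]
  refine prod_le_prod' fun i hi => ?_
  have hit : i < t := mem_range.1 hi
  -- `k 2^i ≤ k 2^{t-1} ≤ 2n`
  have hki : k * 2 ^ i ≤ 2 * n := by
    have h1 : k * 2 ^ i ≤ k * 2 ^ (t - 1) := Nat.mul_le_mul_left _ (Nat.pow_le_pow_right (by norm_num) (by omega))
    have h2 : k * 2 ^ (t - 1) * 2 = 2 ^ t * k := by
      obtain ⟨t', rfl⟩ : ∃ t', t = t' + 1 := ⟨t - 1, by omega⟩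
      simp [pow_succ]; ring
    omega
  have hdiv : 2 * n / 2 ^ i * 2 ^ i ≤ 2 * n := Nat.div_mul_le_self _ _
  calc 2 * (k + 2 * n / 2 ^ i) * 2 ^ i = 2 * (k * 2 ^ i + 2 * n / 2 ^ i * 2 ^ i) := by ring
    _ ≤ 2 * (2 * n + 2 * n) := by omega
    _ = 8 * n := by ring

/-- **Threading.** With `s₁ = (k/(16n))^t 2^{t(t-1)/2}`: `0 < s₁ ≤ 1`, `n ≤ (k+1-t) M`, and a set of tables `S`
with `(k+1-t)^t (n^M)^t ≤ #S · ∏_{i<t} 2(k + 2n/2^i)` has `s₁ · n^{tM} ≤ #S` (`n^{tM} = |Ω|`). [folklore] -/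
theorem threading6 {n k t M : ℕ} (hn : 0 < n) (h2tk : 2 ^ t * k ≤ 4 * n) (h2t : 2 * t ≤ k) (h4n : 4 * n < k * M) :
    0 < ((k : ℝ) / (16 * n)) ^ t * 2 ^ (t * (t - 1) / 2) ∧ ((k : ℝ) / (16 * n)) ^ t * 2 ^ (t * (t - 1) / 2) ≤ 1 ∧
      n ≤ (k + 1 - t) * M ∧
      ∀ S : ℕ, (k + 1 - t) ^ t * (n ^ M) ^ t ≤ S * ∏ i ∈ range t, (2 * (k + 2 * n / 2 ^ i)) →
        ((k : ℝ) / (16 * n)) ^ t * 2 ^ (t * (t - 1) / 2) * (Fintype.card (Fin t → Fin M → Fin n) : ℝ) ≤ S := by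
  have hk0 : 0 < k := by
    rcases Nat.eq_zero_or_pos k with h | h
    · subst h; simp at h4n
    · exact h
  have hn' : (0 : ℝ) < n := by exact_mod_cast hn
  have hk' : (0 : ℝ) < k := by exact_mod_cast hk0
  have hP := prod_pool_bound_le h2tk
  set P := ∏ i ∈ range t, (2 * (k + 2 * n / 2 ^ i)) with hPdef
  set E2 := 2 ^ (t * (t - 1) / 2) with hE2
  refine ⟨by positivity, ?_, ?_, ?_⟩
  · -- `s₁ ≤ 1`: `k^t 2^{T2} ≤ (16 n)^t` from `k^t · P · 2^{T2}`? direct: `(k 2^{(t-1)})^t ≥ k^t 2^{T2}`... use `P ≥ (2k)^t`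
    -- simpler: `k/(16n) · 2^{(t-1)/…}`: we use `k^t E2 ≤ P E2 ≤ (8n)^t ≤ (16 n)^t` since `2k ≤ 2(k + 2n/2^i)`
    have hkP : k ^ t ≤ P := by
      rw [hPdef, ← card_range t, ← prod_const, card_range]
      exact prod_le_prod' fun i _ => le_trans (Nat.le_add_right k _) (Nat.le_mul_of_pos_left _ (by norm_num))
    have h1 : k ^ t * E2 ≤ (16 * n) ^ t := by
      calc k ^ t * E2 ≤ P * E2 := Nat.mul_le_mul_right _ hkP
        _ ≤ (8 * n) ^ t := hP
        _ ≤ (16 * n) ^ t := Nat.pow_le_pow_left (by omega) t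
    have h1' : ((k ^ t * E2 : ℕ) : ℝ) ≤ (((16 * n) ^ t : ℕ) : ℝ) := by exact_mod_cast h1
    push_cast at h1'
    rw [div_pow, div_mul_eq_mul_div, div_le_one (by positivity)]
    rw [hE2] at h1'; push_cast at h1'
    exact h1'
  · -- `n ≤ (k+1-t) M`: `2 (k+1-t) ≥ k` and `k M > 4n`
    have h1 : k ≤ 2 * (k + 1 - t) := by omega
    have h2 : k * M ≤ 2 * ((k + 1 - t) * M) := by
      calc k * M ≤ 2 * (k + 1 - t) * M := Nat.mul_le_mul_right _ h1
        _ = 2 * ((k + 1 - t) * M) := by ring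
    omega
  · intro S hS
    have hcard : (Fintype.card (Fin t → Fin M → Fin n) : ℝ) = ((n : ℝ) ^ M) ^ t := by
      rw [Fintype.card_fun, Fintype.card_fun, Fintype.card_fin, Fintype.card_fin, Fintype.card_fin]; push_cast; ring
    -- `(k+1-t)^t (n^M)^t E2 ≤ S P E2 ≤ S (8n)^t`
    have h1 : (k + 1 - t) ^ t * (n ^ M) ^ t * E2 ≤ S * (8 * n) ^ t := by
      calc (k + 1 - t) ^ t * (n ^ M) ^ t * E2 ≤ S * P * E2 := Nat.mul_le_mul_right _ hS
        _ = S * (P * E2) := by ring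
        _ ≤ S * (8 * n) ^ t := Nat.mul_le_mul_left _ hP
    have hkt : k ≤ 2 * (k + 1 - t) := by omega
    have h2 : k ^ t * (n ^ M) ^ t * E2 ≤ 2 ^ t * (S * (8 * n) ^ t) := by
      calc k ^ t * (n ^ M) ^ t * E2 ≤ (2 * (k + 1 - t)) ^ t * (n ^ M) ^ t * E2 := by
            gcongr
        _ = 2 ^ t * ((k + 1 - t) ^ t * (n ^ M) ^ t * E2) := by rw [mul_pow]; ring
        _ ≤ 2 ^ t * (S * (8 * n) ^ t) := Nat.mul_le_mul_left _ h1
    have h2' : ((k ^ t * (n ^ M) ^ t * E2 : ℕ) : ℝ) ≤ ((2 ^ t * (S * (8 * n) ^ t) : ℕ) : ℝ) := by exact_mod_cast h2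
    push_cast at h2'
    rw [hcard, div_pow]
    -- goal: `k^t/(16n)^t · E2 · (n^M)^t ≤ S`
    have h16 : (0 : ℝ) < (16 * (n : ℝ)) ^ t := by positivity
    rw [show (k : ℝ) ^ t / (16 * (n : ℝ)) ^ t * (2 : ℝ) ^ (t * (t - 1) / 2) * ((n : ℝ) ^ M) ^ t =
      ((k : ℝ) ^ t * ((n : ℝ) ^ M) ^ t * (2 : ℝ) ^ (t * (t - 1) / 2)) / (16 * (n : ℝ)) ^ t by ring]
    rw [div_le_iff₀ h16]
    have hE2' : ((E2 : ℕ) : ℝ) = (2 : ℝ) ^ (t * (t - 1) / 2) := by rw [hE2]; push_cast; ring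
    rw [← hE2']
    calc (k : ℝ) ^ t * ((n : ℝ) ^ M) ^ t * (E2 : ℝ) ≤ 2 ^ t * ((S : ℝ) * (8 * (n : ℝ)) ^ t) := h2'
      _ = (S : ℝ) * (16 * (n : ℝ)) ^ t := by
          have hpow16 : (16 * (n : ℝ)) ^ t = 2 ^ t * (8 * (n : ℝ)) ^ t := by
            rw [← mul_pow]; ring_nf
          rw [hpow16]; ring

/-! ### The hypergeometric term -/

/-- **The hypergeometric term is negligible**: for `s = k - ⌊k/2⌋`, `C(tM, s) · C(k, s) ≤ C(n, s) · 2^{-k}`. [folklore] -/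
theorem hyper6 {n k t M : ℕ} (h32 : 32 * (t * M) ≤ n) (h6k : 6 * k ≤ n) (hk : 1 ≤ k) :
    ((((t * M).choose (k - k / 2)) * (k.choose (k - k / 2)) : ℕ) : ℝ) ≤ (n.choose (k - k / 2) : ℝ) * (2 : ℝ)⁻¹ ^ k := by
  set s := k - k / 2 with hs
  have hs2 : k ≤ 2 * s := by omega
  have hsk : s ≤ k := Nat.sub_le _ _
  have hsn : 2 * s ≤ n + 2 := by omega
  have hn0 : (0 : ℝ) < n := by exact_mod_cast (show 0 < n by omega)
  -- `C(tM, s) ≤ (tM)^s / s!`, `C(k, s) ≤ 2^k`, `(n+1-s)^s / s! ≤ C(n, s)`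
  have h1 : (((t * M).choose s : ℕ) : ℝ) ≤ ((t * M : ℕ) : ℝ) ^ s / (s.factorial : ℝ) := by
    have := Nat.choose_le_pow_div (α := ℝ) s (t * M)
    push_cast at this ⊢; exact this
  have h2 : ((k.choose s : ℕ) : ℝ) ≤ (2 : ℝ) ^ k := by exact_mod_cast Nat.choose_le_two_pow k s
  have h3 : ((n + 1 - s : ℕ) : ℝ) ^ s / (s.factorial : ℝ) ≤ (n.choose s : ℝ) := by
    have := Nat.pow_le_choose (α := ℝ) s n
    exact_mod_cast this
  have hfac : (0 : ℝ) < s.factorial := by exact_mod_cast Nat.factorial_pos s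
  -- `(tM)^s ≤ (n+1-s)^s · (1/16)^s`: `16 tM ≤ n/2 ≤ n + 1 - s`
  have hbase : 16 * ((t * M : ℕ) : ℝ) ≤ ((n + 1 - s : ℕ) : ℝ) := by
    have h : 16 * (t * M) ≤ n + 1 - s := by omega
    exact_mod_cast h
  have hpow : ((t * M : ℕ) : ℝ) ^ s * 16 ^ s ≤ ((n + 1 - s : ℕ) : ℝ) ^ s := by
    rw [← mul_pow]
    exact pow_le_pow_left₀ (by positivity) (by linarith) s
  -- assemble: `C(tM,s) C(k,s) ≤ (tM)^s 2^k / s! ≤ (n+1-s)^s/(16^s s!) 2^k ≤ C(n,s) 2^k/16^s ≤ C(n,s) 2^{-k}`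
  have h16s : (2 : ℝ) ^ k * (2 : ℝ) ^ k ≤ 16 ^ s := by
    rw [← pow_add, show (16 : ℝ) = 2 ^ 4 by norm_num, ← pow_mul]
    exact pow_le_pow_right₀ (by norm_num) (by omega)
  have hC0 : (0 : ℝ) ≤ ((t * M).choose s : ℕ) := Nat.cast_nonneg _
  have hK0 : (0 : ℝ) ≤ (k.choose s : ℕ) := Nat.cast_nonneg _
  have step1 : ((((t * M).choose s) * (k.choose s) : ℕ) : ℝ) ≤ ((t * M : ℕ) : ℝ) ^ s / s.factorial * (2 : ℝ) ^ k := by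
    have hc : ((((t * M).choose s) * (k.choose s) : ℕ) : ℝ) = (((t * M).choose s : ℕ) : ℝ) * ((k.choose s : ℕ) : ℝ) :=
      Nat.cast_mul _ _
    rw [hc]
    exact mul_le_mul h1 h2 hK0 (by positivity)
  refine step1.trans ?_
  rw [div_mul_eq_mul_div, div_le_iff₀ hfac]
  -- `(tM)^s 2^k ≤ C(n,s) 2^{-k} s!`; use `(n+1-s)^s ≤ C(n,s) s!`
  have h3' : ((n + 1 - s : ℕ) : ℝ) ^ s ≤ (n.choose s : ℝ) * s.factorial := by
    rwa [div_le_iff₀ hfac] at h3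
  have hinv : (2 : ℝ)⁻¹ ^ k * (2 : ℝ) ^ k = 1 := by rw [inv_pow, inv_mul_cancel₀ (by positivity)]
  -- multiply target inequality through: `(tM)^s 2^k · 16^s ≤ (n+1-s)^s 2^k ≤ C(n,s) s! 2^k` and `2^k 2^k ≤ 16^s`
  have key : ((t * M : ℕ) : ℝ) ^ s * (2 : ℝ) ^ k * ((2 : ℝ) ^ k * (2 : ℝ) ^ k) ≤
      (n.choose s : ℝ) * (2 : ℝ)⁻¹ ^ k * s.factorial * ((2 : ℝ) ^ k * (2 : ℝ) ^ k) := by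
    calc ((t * M : ℕ) : ℝ) ^ s * (2 : ℝ) ^ k * ((2 : ℝ) ^ k * (2 : ℝ) ^ k)
        ≤ ((t * M : ℕ) : ℝ) ^ s * (2 : ℝ) ^ k * 16 ^ s := mul_le_mul_of_nonneg_left h16s (by positivity)
      _ = (((t * M : ℕ) : ℝ) ^ s * 16 ^ s) * (2 : ℝ) ^ k := by ring
      _ ≤ ((n + 1 - s : ℕ) : ℝ) ^ s * (2 : ℝ) ^ k := mul_le_mul_of_nonneg_right hpow (by positivity)
      _ ≤ ((n.choose s : ℝ) * s.factorial) * (2 : ℝ) ^ k := mul_le_mul_of_nonneg_right h3' (by positivity)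
      _ = (n.choose s : ℝ) * (2 : ℝ)⁻¹ ^ k * s.factorial * ((2 : ℝ) ^ k * (2 : ℝ) ^ k) := by
          rw [show (n.choose s : ℝ) * (2 : ℝ)⁻¹ ^ k * s.factorial * ((2 : ℝ) ^ k * (2 : ℝ) ^ k) =
            (n.choose s : ℝ) * s.factorial * (2 : ℝ) ^ k * ((2 : ℝ)⁻¹ ^ k * (2 : ℝ) ^ k) by ring, hinv, mul_one]
  exact le_of_mul_le_mul_right key (by positivity)

/-! ### The number of trials -/

/-- **The number of trials.** For `0 < s₁ ≤ 1`, `s₁ ≥ (k/(16n))^t 2^{t(t-1)/2}`-shaped (here: any `s₁` with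
`(16 n)^{-t} ≤ s₁`), `R = ⌈(L+1)/s₁⌉`: `(1-s₁)^R ≤ e^{-(L+1)}` and `R ≤ exp(32 (L+1)²)`; consequently
`R e^{-(L+1)⁶/512} ≤ e^{-(L+1)}` and `R 2^{-k} ≤ e^{-(L+1)}`. [folklore] -/
theorem trials6 {n k L t : ℕ} {s₁ : ℝ} (hs0 : 0 < s₁) (hs1 : s₁ ≤ 1) (hslo : ((16 * (n : ℝ)) ^ t)⁻¹ ≤ s₁)
    (hnL : n < 2 ^ (L + 1)) (ht : t ≤ 7 * L + 23) (hL11 : 11 ≤ L) (hkBig : 640 * (L + 1) ^ 6 ≤ k) (hn : 0 < n) :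
    (1 - s₁) ^ ⌈((L : ℝ) + 1) / s₁⌉₊ ≤ Real.exp (-((L : ℝ) + 1)) ∧
      (⌈((L : ℝ) + 1) / s₁⌉₊ : ℝ) ≤ Real.exp (32 * ((L : ℝ) + 1) ^ 2) ∧
      (⌈((L : ℝ) + 1) / s₁⌉₊ : ℝ) * Real.exp (-(((L : ℝ) + 1) ^ 6 / 512)) ≤ Real.exp (-((L : ℝ) + 1)) ∧
      (⌈((L : ℝ) + 1) / s₁⌉₊ : ℝ) * (2 : ℝ)⁻¹ ^ k ≤ Real.exp (-((L : ℝ) + 1)) := by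
  set R := ⌈((L : ℝ) + 1) / s₁⌉₊ with hR
  have hL0 : (0 : ℝ) ≤ L := Nat.cast_nonneg L
  have hL11' : (11 : ℝ) ≤ L := by exact_mod_cast hL11
  have hRlo : ((L : ℝ) + 1) / s₁ ≤ R := Nat.le_ceil _
  have hRhi : (R : ℝ) < ((L : ℝ) + 1) / s₁ + 1 := Nat.ceil_lt_add_one (by positivity)
  -- (1) `(1-s₁)^R ≤ exp(-s₁ R) ≤ exp(-(L+1))`
  have h1 : (1 - s₁) ^ R ≤ Real.exp (-((L : ℝ) + 1)) := by
    have ha : 1 - s₁ ≤ Real.exp (-s₁) := by linarith [Real.add_one_le_exp (-s₁)]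
    calc (1 - s₁) ^ R ≤ (Real.exp (-s₁)) ^ R := pow_le_pow_left₀ (by linarith) ha R
      _ = Real.exp (-(s₁ * R)) := by rw [← Real.exp_nat_mul]; ring_nf
      _ ≤ Real.exp (-((L : ℝ) + 1)) := Real.exp_le_exp.2 (by
          have : (L : ℝ) + 1 ≤ s₁ * R := by rw [div_le_iff₀' hs0] at hRlo; exact hRlo
          linarith)
  -- (2) `R ≤ (L+2)/s₁ ≤ (L+2) (16n)^t ≤ exp(32 (L+1)^2)`
  have h2 : (R : ℝ) ≤ Real.exp (32 * ((L : ℝ) + 1) ^ 2) := by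
    have hn' : (0 : ℝ) < n := by exact_mod_cast hn
    have h16n : (0 : ℝ) < (16 * (n : ℝ)) ^ t := by positivity
    have hRle : (R : ℝ) ≤ ((L : ℝ) + 2) * (16 * (n : ℝ)) ^ t := by
      have hinv : 1 / s₁ ≤ (16 * (n : ℝ)) ^ t := by
        rw [div_le_iff₀ hs0]
        have := mul_le_mul_of_nonneg_left hslo h16n.le
        rwa [mul_inv_cancel₀ h16n.ne'] at this
      have : ((L : ℝ) + 1) / s₁ + 1 ≤ ((L : ℝ) + 2) * (16 * (n : ℝ)) ^ t := by
        have h1n : (1 : ℝ) ≤ n := by exact_mod_cast hn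
        have h1t : (1 : ℝ) ≤ (16 * (n : ℝ)) ^ t := one_le_pow₀ (by linarith)
        calc ((L : ℝ) + 1) / s₁ + 1 = ((L : ℝ) + 1) * (1 / s₁) + 1 := by ring
          _ ≤ ((L : ℝ) + 1) * (16 * (n : ℝ)) ^ t + (16 * (n : ℝ)) ^ t := by
              nlinarith [mul_le_mul_of_nonneg_left hinv (by positivity : (0 : ℝ) ≤ (L : ℝ) + 1)]
          _ = ((L : ℝ) + 2) * (16 * (n : ℝ)) ^ t := by ring
      linarith
    refine hRle.trans ?_
    -- `L + 2 ≤ e^{L+1}`, `16 n ≤ 2^{L+5} ≤ e^{L+5}`, so `≤ exp(L+1 + (L+5) t) ≤ exp(32 (L+1)^2)`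
    have hA : (L : ℝ) + 2 ≤ Real.exp ((L : ℝ) + 1) := by linarith [Real.add_one_le_exp ((L : ℝ) + 1)]
    have hB : 16 * (n : ℝ) ≤ Real.exp ((L : ℝ) + 5) := by
      have hn2 : (n : ℝ) ≤ 2 ^ (L + 1) := by exact_mod_cast hnL.le
      have h2e : (2 : ℝ) ^ (L + 5) ≤ Real.exp ((L : ℝ) + 5) := by
        calc (2 : ℝ) ^ (L + 5) ≤ (Real.exp 1) ^ (L + 5) :=
              pow_le_pow_left₀ (by norm_num) (by linarith [Real.add_one_le_exp (1 : ℝ)]) _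
          _ = Real.exp ((L : ℝ) + 5) := by rw [← Real.exp_nat_mul, mul_one]; push_cast; ring
      calc 16 * (n : ℝ) ≤ 16 * 2 ^ (L + 1) := by linarith
        _ = (2 : ℝ) ^ (L + 5) := by ring
        _ ≤ _ := h2e
    have hBt : (16 * (n : ℝ)) ^ t ≤ Real.exp (((L : ℝ) + 5) * t) := by
      calc (16 * (n : ℝ)) ^ t ≤ (Real.exp ((L : ℝ) + 5)) ^ t := pow_le_pow_left₀ (by positivity) hB t
        _ = Real.exp (((L : ℝ) + 5) * t) := by rw [← Real.exp_nat_mul]; ring_nf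
    have ht' : (t : ℝ) ≤ 7 * L + 23 := by exact_mod_cast ht
    calc ((L : ℝ) + 2) * (16 * (n : ℝ)) ^ t ≤ Real.exp ((L : ℝ) + 1) * Real.exp (((L : ℝ) + 5) * t) :=
          mul_le_mul hA hBt (by positivity) (Real.exp_pos _).le
      _ = Real.exp ((L : ℝ) + 1 + ((L : ℝ) + 5) * t) := (Real.exp_add _ _).symm
      _ ≤ Real.exp (32 * ((L : ℝ) + 1) ^ 2) := Real.exp_le_exp.2 (by nlinarith)
  refine ⟨h1, h2, ?_, ?_⟩
  · -- `exp(32 (L+1)^2) exp(-(L+1)^6/512) ≤ exp(-(L+1))` since `(L+1)^4 ≥ 12^4 > 512·33`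
    calc (R : ℝ) * Real.exp (-(((L : ℝ) + 1) ^ 6 / 512)) ≤ Real.exp (32 * ((L : ℝ) + 1) ^ 2) * Real.exp (-(((L : ℝ) + 1) ^ 6 / 512)) :=
          mul_le_mul_of_nonneg_right h2 (Real.exp_pos _).le
      _ = Real.exp (32 * ((L : ℝ) + 1) ^ 2 + -(((L : ℝ) + 1) ^ 6 / 512)) := (Real.exp_add _ _).symm
      _ ≤ Real.exp (-((L : ℝ) + 1)) := Real.exp_le_exp.2 (by
          have hsq : (144 : ℝ) ≤ ((L : ℝ) + 1) ^ 2 := by nlinarith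
          have h4 : (20736 : ℝ) ≤ ((L : ℝ) + 1) ^ 4 := by nlinarith
          have h6 : ((L : ℝ) + 1) ^ 6 = ((L : ℝ) + 1) ^ 4 * ((L : ℝ) + 1) ^ 2 := by ring
          nlinarith)
  · -- `exp(32 (L+1)^2) 2^{-k} ≤ exp(-(L+1))` since `k ≥ 640 (L+1)^6` and `2^{-k} ≤ e^{-k/2}`
    have hk' : (640 : ℝ) * ((L : ℝ) + 1) ^ 6 ≤ k := by exact_mod_cast hkBig
    have h2k : (2 : ℝ)⁻¹ ^ k ≤ Real.exp (-((k : ℝ) / 2)) := by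
      -- `2^{-1} ≤ e^{-1/2}` as `e^{1/2} ≤ 2`... use `exp(1/2)^2 = e ≤ 4`
      have he : Real.exp (1 / 2) ≤ 2 := by
        have h := Real.exp_one_lt_d9
        have hsq : Real.exp (1 / 2) ^ 2 = Real.exp 1 := by rw [← Real.exp_nat_mul]; norm_num
        nlinarith [Real.exp_pos (1 / 2 : ℝ)]
      have hinv : (2 : ℝ)⁻¹ ≤ Real.exp (-(1 / 2)) := by
        rw [Real.exp_neg, inv_le_inv₀ (by norm_num) (Real.exp_pos _)]; exact he
      calc (2 : ℝ)⁻¹ ^ k ≤ (Real.exp (-(1 / 2))) ^ k := pow_le_pow_left₀ (by norm_num) hinv k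
        _ = Real.exp (-((k : ℝ) / 2)) := by rw [← Real.exp_nat_mul]; ring_nf
    calc (R : ℝ) * (2 : ℝ)⁻¹ ^ k ≤ Real.exp (32 * ((L : ℝ) + 1) ^ 2) * Real.exp (-((k : ℝ) / 2)) :=
          mul_le_mul h2 h2k (by positivity) (Real.exp_pos _).le
      _ = Real.exp (32 * ((L : ℝ) + 1) ^ 2 + -((k : ℝ) / 2)) := (Real.exp_add _ _).symm
      _ ≤ Real.exp (-((L : ℝ) + 1)) := Real.exp_le_exp.2 (by
          have hsq : (144 : ℝ) ≤ ((L : ℝ) + 1) ^ 2 := by nlinarith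
          have h6 : ((L : ℝ) + 1) ^ 6 = ((L : ℝ) + 1) ^ 2 * ((L : ℝ) + 1) ^ 2 * ((L : ℝ) + 1) ^ 2 := by ring
          nlinarith)

end Summit.PneNP.PneNP.Theorems.MonotoneSuffices.Greedy

namespace Summit.PneNP.PneNP.Theorems.MonotoneSuffices.Greedy

/-- Registered sub-goal `greedy_paramsC` of stmt-PneNP-18026 (greedy detector, part 10d): the product bound behind
the threading probability, exported verbatim. [folklore] -/
theorem greedy_paramsC :
    ∀ {n k t : ℕ}, 2 ^ t * k ≤ 4 * n → (∏ i ∈ Finset.range t, (2 * (k + 2 * n / 2 ^ i))) * 2 ^ (t * (t - 1) / 2) ≤ (8 * n) ^ t :=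
  fun h => prod_pool_bound_le h

end Summit.PneNP.PneNP.Theorems.MonotoneSuffices.Greedy
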